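import Summits.PneNP.PneNP.Theses.MonochromaticLines
import Literature.Computability.Complexity.ClayProblemProofs

/-!
# Route MonochromaticLines — `ClassBridge` (stmt-PneNP-11760)

Model bridge: if every Cook-`NP` language over `Bool` is Cook-`P` (`PNPWave0.NP Bool ⊆ PNPWave0.P Bool`) then
`Nondeterministic.NP ⊆ Classes.P`; three lines from the proved bridges `P_bool_eq_holds` (ClayProblem) and `NP_bool_eq_holds`
(ClayProblemProofs), kept out of the route file's imports.
-/

set_option linter.dupNamespace false -- `Summit.PneNP.PneNP.…`: summit = sub-problem name (D-0017 single-conjunct layout)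

namespace Summit.PneNP.PneNP.Theorems

/-- **Support item `ClassBridge` of route MonochromaticLines (stmt-PneNP-11760)**:
`PNPWave0.NP Bool ⊆ PNPWave0.P Bool → Nondeterministic.NP ⊆ Classes.P`, by rewriting with the proved model bridges
`P_bool_eq_holds : PNPWave0.P Bool = Classes.P` and `NP_bool_eq_holds : PNPWave0.NP Bool = Nondeterministic.NP`.
[cite: AroraBarakCC2009, Def. 2.1] [folklore] -/
theorem monochromaticLines_classBridge_proof : Summit.PneNP.PneNP.Theses.MonochromaticLines.ClassBridge := by
  unfold Summit.PneNP.PneNP.Theses.MonochromaticLines.ClassBridge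
  intro h
  have hP : Literature.Computability.Complexity.PNPWave0.P Bool = Literature.Computability.Complexity.Classes.P :=
    Literature.Computability.Complexity.P_bool_eq_holds
  have hN : Literature.Computability.Complexity.PNPWave0.NP Bool =
      Literature.Computability.Complexity.Nondeterministic.NP :=
    Literature.Computability.Complexity.NP_bool_eq_holds
  rw [hP, hN] at h
  exact h

end Summit.PneNP.PneNP.Theorems
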